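import Summits.Schanuel.Schanuel.Theorems.KhovanskiiApproxType.Negative.LoadBearing
import Summits.Schanuel.Schanuel.Theorems.DiophantineDichotomyKhovanskiiApproxTypeSlotDichotomyTwo
import Literature.NumberTheory.DiophantineApproximation.IntegerPolynomialSmallValue

/-!
# Dirichlet tightness of the slot floors (crux `KhovanskiiApproxType`, stmt-Schanuel-6116, negative lane)

Vocabulary of line `lw-small-height` (`Theorems/DiophantineDichotomyDefs.lean`): a SLOT FLOOR
`SlotFloor ξ A K C` is the one-variable codimension-one measure
`log|P(ξ)| ≥ −C((max 1 deg P)^A log(max 1 H(P)) + (max 1 deg P)^K)` for all non-zero `P ∈ ℤ[X₀]`.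
`slotFloor_false_of_lt_one`: NO complex number has a floor with degree exponent `A < 1` — Dirichlet's
box principle (Bugeaud 2004 Lemma 8.1, proved in tree as `exists_int_poly_small_value`: a non-zero
`P` with `deg P ≤ n`, `H(P) ≤ H`, `|P(ξ)| ≤ H^{−0.455 n}`) beats it once `C n^{max A 0} ≤ 0.003 n`
(`exists_deg`) and `log H > C n^{max K 0}`. So in `NonLWInputsTwo` / `SlotDichotomyTwo` the floor
exponent necessarily satisfies `A ≥ 1` (the line uses `A ∈ [1, 2)`); recorded for pruning.
[cite: Bugeaud2004, Lemma 8.1]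
-/

noncomputable section

set_option linter.dupNamespace false

namespace Summit.Schanuel.Schanuel.Cruxes.KhovanskiiApproxType.Negative

open Summit.Schanuel.Schanuel.Cruxes.KhovanskiiApproxType.LwSmallHeight
open Polynomial
open Literature.NumberTheory.DiophantineApproximation (exists_int_poly_small_value)

set_option maxHeartbeats 400000 in
/-- **No slot floor with degree exponent `A < 1` exists, at any `ξ ∈ ℂ`** (Dirichlet / Bugeaud
Lemma 8.1). [cite: Bugeaud2004, Lemma 8.1] -/
theorem slotFloor_false_of_lt_one (ξ : ℂ) (A K C : ℝ) (hA : A < 1) : ¬ SlotFloor ξ A K C := by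
  rintro ⟨hC, hfl⟩
  set A' : ℝ := max A 0 with hA'
  set K' : ℝ := max K 0 with hK'
  have hA'1 : A' < 1 := max_lt hA one_pos
  have hA'0 : 0 ≤ A' := le_max_right _ _
  have hK'0 : 0 ≤ K' := le_max_right _ _
  obtain ⟨n, hn50, hn⟩ := exists_deg A' C hA'1 hC
  have hn1 : (1 : ℝ) ≤ n := by exact_mod_cast (le_trans (by norm_num) hn50)
  have hnpos : (0 : ℝ) < n := by linarith
  -- the height scale
  set H : ℝ := max ((4 + ‖ξ‖) ^ 50) (Real.exp (C * (n : ℝ) ^ K' + 1)) with hHdef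
  have hHξ : (4 + ‖ξ‖) ^ 50 ≤ H := le_max_left _ _
  have hH4 : (4 : ℝ) ^ 50 ≤ H :=
    le_trans (pow_le_pow_left₀ (by norm_num) (by linarith [norm_nonneg ξ]) 50) hHξ
  have hH1 : (1 : ℝ) ≤ H := le_trans (by norm_num) hH4
  have hH0 : 0 < H := by linarith
  have hlogH : C * (n : ℝ) ^ K' + 1 ≤ Real.log H := by
    rw [Real.le_log_iff_exp_le hH0]; exact le_max_right _ _
  have hlogH0 : 0 ≤ Real.log H := Real.log_nonneg hH1
  -- Dirichlet
  obtain ⟨P, hP0, hPdeg, hPcoeff, hPval⟩ := exists_int_poly_small_value ξ n hn50 H hHξ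
  -- feed the floor
  have hQ0 : P.toMvPolynomial (0 : Fin 1) ≠ 0 := fun h =>
    hP0 (Polynomial.toMvPolynomial_injective (0 : Fin 1) (by rw [h, map_zero]))
  have hkey := hfl (P.toMvPolynomial (0 : Fin 1)) hQ0
  rw [MvPolynomial.aeval_toMvPolynomial] at hkey
  -- sizes of the image
  have hnat : ∀ k, (P.coeff k).natAbs ≤ ⌊H⌋₊ := fun k => by
    rw [Nat.le_floor_iff hH0.le, ← Int.cast_natCast, Int.natCast_natAbs, Int.cast_abs]
    exact hPcoeff k
  obtain ⟨hFdeg, hFht⟩ := totalDegree_mvNatHeight_toMvPolynomial_le P ⌊H⌋₊ hnat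
  set X₁ : ℝ := max 1 ((P.toMvPolynomial (0 : Fin 1)).totalDegree : ℝ) with hX₁
  set Y₁ : ℝ := max 1 (mvNatHeight (P.toMvPolynomial (0 : Fin 1)) : ℝ) with hY₁
  have hX1 : 1 ≤ X₁ := le_max_left _ _
  have hXn : X₁ ≤ n := max_le hn1 (by exact_mod_cast hFdeg.trans hPdeg)
  have hY1 : 1 ≤ Y₁ := le_max_left _ _
  have hYH : Y₁ ≤ H := max_le hH1 ((show (mvNatHeight (P.toMvPolynomial (0 : Fin 1)) : ℝ) ≤
    (⌊H⌋₊ : ℝ) by exact_mod_cast hFht).trans (Nat.floor_le hH0.le))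
  have hlogY : Real.log Y₁ ≤ Real.log H := Real.log_le_log (by linarith) hYH
  have hlogY0 : 0 ≤ Real.log Y₁ := Real.log_nonneg hY1
  have hXA : X₁ ^ A ≤ (n : ℝ) ^ A' :=
    (Real.rpow_le_rpow_of_exponent_le hX1 (le_max_left _ _)).trans
      (Real.rpow_le_rpow (by linarith) hXn hA'0)
  have hXK : X₁ ^ K ≤ (n : ℝ) ^ K' :=
    (Real.rpow_le_rpow_of_exponent_le hX1 (le_max_left _ _)).trans
      (Real.rpow_le_rpow (by linarith) hXn hK'0)
  have hnA0 : 0 ≤ (n : ℝ) ^ A' := by positivity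
  -- the floor exponent is at most 0.003 n log H + C n^K'
  have hexpo : C * (X₁ ^ A * Real.log Y₁ + X₁ ^ K) ≤ 3 / 1000 * n * Real.log H + C * (n : ℝ) ^ K' := by
    have h1 : X₁ ^ A * Real.log Y₁ ≤ (n : ℝ) ^ A' * Real.log H :=
      mul_le_mul hXA hlogY hlogY0 hnA0
    have h2 : C * ((n : ℝ) ^ A' * Real.log H) ≤ 3 / 1000 * n * Real.log H := by
      have := mul_le_mul_of_nonneg_right hn hlogH0
      linarith
    have h3 := mul_le_mul_of_nonneg_left (add_le_add h1 hXK) hC.le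
    linarith
  -- compare with Dirichlet's upper bound
  have hlow : Real.exp (-(3 / 1000 * n * Real.log H + C * (n : ℝ) ^ K')) ≤ ‖aeval ξ P‖ :=
    (Real.exp_le_exp.mpr (by linarith)).trans hkey
  have hchain := hlow.trans hPval
  rw [Real.exp_le_exp] at hchain
  -- 0.455 n log H ≤ 0.003 n log H + C n^K'  contradicts  log H > C n^K'  (n ≥ 50)
  have h45 : (452 / 1000 : ℝ) * n * Real.log H ≥ Real.log H := by
    have : (1 : ℝ) ≤ 452 / 1000 * n := by
      have h50 : (50 : ℝ) ≤ n := by exact_mod_cast hn50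
      linarith
    nlinarith
  linarith

end Summit.Schanuel.Schanuel.Cruxes.KhovanskiiApproxType.Negative

end
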